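/-
Copyright (c) 2026 the pub-hodgecm-mathlib formalisation cell (harness21).  Prover seat hodgecm-mathlib-LH4-p14 (g3): Track A «(D-RAM) FOUR-FRAME» squad of crux H413, unit U2H (ii-H),
ROW (2) census leaf (ρ2b′-X) — SECOND ASSEMBLY LAYER of the payer plan (LH4-p12 (g3) PAYER-PLAN-rho2bX v2 8ff3a79c, this seat's RHO2BX-ORGANS v1 1f3a2da3): the two SIDES of
the lattice census, 2026-09-04.
-/
import Summits.HodgeConjecture.HodgeConjecture.Theorems.F0P3cDyRamFixedPointLawTypeTwoReduction   -- ★ p856286 (LH4-p06 (g3)): the parent (ρ2b′) composition; brings every token of :418 (`IsLocalGRegular`, `finCharpolyTwo`, `finGammaTwo`, `IsLocalNormPair`, `finKappaAt`, `hilbertSymbol`, `shiftR`, …)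
import HarnessLib

/-!
# F0 · P3c · line LH4 «(D-RAM) FOUR-FRAME» — unit (ii-H), leaf (ρ2b′-X): THE LATTICE CENSUS SPLIT INTO ITS H-SIDE AND ITS G-SIDE THROUGH A SHARED VERTEX NUMBER
(Rogawski 1990 §4.9 Prop. 4.9.1 (b), Lemma 4.9.3; Labesse–Langlands 1979 §2; Kottwitz 1988 §2)

Cell `pub/hodgecm-mathlib`, crux H413 = `stmt-HodgeConjecture-24833` (helper lane, count-neutral); THEOREMS ONLY (no definition, no instance, no notation, no named fact, no `sorry`,
default heartbeats), typed under the LINE FILE's scopes.  Tree socket served (one layer up): (ρ2b′-X) `stub_U2H_fixedPointCensus_typeTwo_unit0` of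
`Cruxes/H413/Lines/F0_P3c_DyRamFourFrame_U2H_HSide.lean` (ED. 15 :418) via this seat's layer 1 `F0P3cDyRamFixedPointCensusTypeTwoLattice.fixedPointCensus_typeTwo_unit0_of_latticeCensus`
(cand 75ab29376fb48e0a, p857061), whose hypothesis (ρ2b′-XL) — the law read on self-dual lattices — is THIS file's conclusion, token for token.

WHAT IS PROVED (pure bookkeeping over `ℂ`, no census mathematics): **`latticeCensus_of_hSide_of_gSide`** — (ρ2b′-XL) from TWO one-sided censuses that meet in a shared natural
number `NV(γ_H)` (an ARBITRARY invariant `NV : H_v → ℕ`, a parameter of the theorem — the payers instantiate it; in print it is `(q − 1)·#{λ♭-fixed vertices of the tree of SL₂(L⁺_v)} + 2`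
= `(q + 1)·qⁿ` for an inert and `2·q^{n+1}` for a ramified eigen-order of level `n`, ★ `SLTwoTreeFixedSubtreeCount` §2):
* `hH` — THE H-SIDE CENSUS near `1`: `(q_w − 1)·(#Fix_{γ₂}(U₂ ⧸ K₂) + d % 2) + 2 = NV(γ_H)` on the `G`-regular type-(2) population (organs: ★ p856225 §1–§3, ★ p847070, ★
  `SLTwoTreeFixedSubtreeCount`, the descent ★ `exists_conj_diagonal_eq_smul_map_toPlace`; to be composed by the H-side payer);
* `hG` — THE G-SIDE CENSUS near `1`: for all tokens `(m, β)` and all signed pairs of matches `(δ₊, δ₋)`,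
  `(q_w − 1)·((β, θ)_v·q_v^{−m}·(#{M self-dual : ι_w(δ₊)·M = M} − #{M self-dual : ι_w(δ₋)·M = M})) = NV(γ_H) − 2 − 2·(q_w^S − 1)`, `S = shiftR d t_E` — the toric∕order census proper
  (payer plan T2 glue decomposition, T3 plane-as-line, T4 order lattices, T5 level census and sum).
The proof intersects the two neighbourhoods and divides by `q_w − 1 ≠ 0` (`q_w ≥ 2`: the residue field is a finite field).

HONEST LABEL: HC_CM is proved only modulo the 7 printed citations (2 remaining named inputs: hLiu418 = stmt-HodgeConjecture-24832, h413 = stmt-HodgeConjecture-24833) until rung 0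
closes; this file is a reduction (count-neutral) — it asserts neither side; (ρ2b′-X), (ρ2b′-XL), `hH`, `hG` stay OPEN prover targets (the law is kit-confirmed, not printed).

## References
* [Rogawski1990] J. D. Rogawski, *Automorphic Representations of Unitary Groups in Three Variables*, Ann. of Math. Stud. 123 (1990), §4.9 Prop. 4.9.1 (b) p. 55, Lemma 4.9.3 p. 56.
* [LabesseLanglands1979] J.-P. Labesse, R. P. Langlands, *L-indistinguishability for SL(2)*, Canad. J. Math. 31 (1979), §2 p. 8 (fixed vertices of an elliptic element).
* [Kottwitz1988] R. E. Kottwitz, *Tamagawa numbers*, Ann. of Math. 127 (1988), §2.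
-/

set_option autoImplicit false

noncomputable section

namespace Summit.HodgeConjecture.HodgeConjecture.Cruxes.H413.F0P3cDyRamFixedPointCensusTypeTwoSides

-- THE LINES MODULE'S `open` CONTEXT (tree `Cruxes/H413/Lines/F0_P3c_DyRamFourFrame_U2H_HSide.lean`, after its `namespace`):
open MeasureTheory Measure NumberField IsDedekindDomain Topology Filter
open Literature.NumberTheory.Automorphic Literature.NumberTheory.Automorphic.UnitaryGroup Literature.NumberTheory.Automorphic.IntegralReduction
open Literature.NumberTheory.Rogawski1990 Literature.NumberTheory.GaloisRepresentations
open Literature.NumberTheory.Automorphic.UnitaryThreeFourFrame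
open Summit.HodgeConjecture.HodgeConjecture.Cruxes.H413.F0P3cDyRamFourFrameHSideDefs
open Summit.HodgeConjecture.HodgeConjecture.Cruxes.H413.F0P3cDyRamFourFrameHFamilyDefs
open scoped Matrix MatrixGroups Classical ValuativeRel
open Summit.HodgeConjecture.HodgeConjecture.Cruxes.H413.F0P3cDyRamFourFrameHSideDefsR
open Summit.HodgeConjecture.HodgeConjecture.Cruxes.H413.F0P3cDyRamFourFrameLawDefsR (shiftT shiftR)
open Literature.NumberTheory.Automorphic.UnitaryLatticeTree Literature.NumberTheory.Automorphic.HermitianLattice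

/-- **(ρ2b′-XL) FROM ITS TWO SIDES** — the lattice census of layer 1 (`F0P3cDyRamFixedPointCensusTypeTwoLattice`) from an H-side census `hH` and a G-side census `hG` that meet
in a shared vertex number `NV(γ_H) ∈ ℕ` (arbitrary invariant; print: `(q − 1)·#Fix(tree) + 2`).  Pure algebra over `ℂ` after intersecting the two neighbourhoods (`q_w ≥ 2`).
[cite: Rogawski1990, §4.9 Prop. 4.9.1 (b) p. 55, Lemma 4.9.3 p. 56] [cite: LabesseLanglands1979, §2 p. 8] [cite: Kottwitz1988, §2] -/
theorem latticeCensus_of_hSide_of_gSide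
    (NV : ∀ (L : Type) [Field L] [NumberField L] [IsCMField L] (v : HeightOneSpectrum (𝓞 ↥(maximalRealSubfield L))) (w : UnitaryGroup.PlacesOver L v),
      IsCMField.complexConj L • w.1 = w.1 → ((UnitaryGroup.cmDatum L 2 (Matrix.of fun i j : Fin 2 => if i.val + j.val + 1 = 2 then (1 : L) else 0)).Local v × (UnitaryGroup.cmDatum L 1 (Matrix.of fun i j : Fin 1 => if i.val + j.val + 1 = 1 then (1 : L) else 0)).Local v) → ℕ)
    (hH :
        ∀ (L : Type) [Field L] [NumberField L] [IsCMField L]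
        {v : HeightOneSpectrum (𝓞 ↥(maximalRealSubfield L))} (w : UnitaryGroup.PlacesOver L v)
        (hw : IsCMField.complexConj L • w.1 = w.1) (_he : v.asIdeal.ramificationIdx' w.1.asIdeal ≠ 1)
        (_h2 : ¬ IsUnit (2 : 𝒪[w.1.adicCompletion L]))
        (ϖ : (w.1.adicCompletion L)) (_hϖ : Valued.v ϖ = WithZero.exp (-1 : ℤ)) (d tE : ℕ) (_hD : IsRamifiedQuadraticDatum (galAdicCompletionMap (L := L) (IsCMField.complexConj L) hw) ϖ d tE)
        [Fintype (Valued.ResidueField (w.1.adicCompletion L))],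
          ∃ V ∈ 𝓝 (1 : ((UnitaryGroup.cmDatum L 2 (Matrix.of fun i j : Fin 2 => if i.val + j.val + 1 = 2 then (1 : L) else 0)).Local v × (UnitaryGroup.cmDatum L 1 (Matrix.of fun i j : Fin 1 => if i.val + j.val + 1 = 1 then (1 : L) else 0)).Local v)), ∀ γH ∈ V, IsLocalGRegular L v γH →
          ¬ (∃ x : (w.1.adicCompletion L), (((((γH).1.val : GL (Fin 2) (UnitaryGroup.LocalRing L v)).val.map (Pi.evalRingHom (fun w' : UnitaryGroup.PlacesOver L v => w'.1.adicCompletion L) w))).charpoly).IsRoot x) →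
          (((Fintype.card (Valued.ResidueField (w.1.adicCompletion L)) : ℕ) : ℂ) - 1) * ((Nat.card (MulAction.fixedBy (((UnitaryGroup.cmDatum L 2 (Matrix.of fun i j : Fin 2 => if i.val + j.val + 1 = 2 then (1 : L) else 0)).Local v) ⧸ cmLocalIntegralLevel L 2 (Matrix.of fun i j : Fin 2 => if i.val + j.val + 1 = 2 then (1 : L) else 0) v) γH.1) : ℂ) + ((d % 2 : ℕ) : ℂ)) + 2 = ((NV L v w hw γH : ℕ) : ℂ))
    (hG :
        ∀ (L : Type) [Field L] [NumberField L] [IsCMField L]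
        {v : HeightOneSpectrum (𝓞 ↥(maximalRealSubfield L))} (w : UnitaryGroup.PlacesOver L v)
        (hw : IsCMField.complexConj L • w.1 = w.1) (_he : v.asIdeal.ramificationIdx' w.1.asIdeal ≠ 1)
        (_h2 : ¬ IsUnit (2 : 𝒪[w.1.adicCompletion L]))
        (ϖ : (w.1.adicCompletion L)) (_hϖ : Valued.v ϖ = WithZero.exp (-1 : ℤ)) (d tE : ℕ) (_hD : IsRamifiedQuadraticDatum (galAdicCompletionMap (L := L) (IsCMField.complexConj L) hw) ϖ d tE)
        [Fintype (Valued.ResidueField (w.1.adicCompletion L))],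
          ∃ V ∈ 𝓝 (1 : ((UnitaryGroup.cmDatum L 2 (Matrix.of fun i j : Fin 2 => if i.val + j.val + 1 = 2 then (1 : L) else 0)).Local v × (UnitaryGroup.cmDatum L 1 (Matrix.of fun i j : Fin 1 => if i.val + j.val + 1 = 1 then (1 : L) else 0)).Local v)), ∀ γH ∈ V, IsLocalGRegular L v γH →
          ¬ (∃ x : (w.1.adicCompletion L), (((((γH).1.val : GL (Fin 2) (UnitaryGroup.LocalRing L v)).val.map (Pi.evalRingHom (fun w' : UnitaryGroup.PlacesOver L v => w'.1.adicCompletion L) w))).charpoly).IsRoot x) →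
          ∀ (m : ℕ) (β : (v.adicCompletion ↥(maximalRealSubfield L))ˣ), Valued.v (((finCharpolyTwo L v γH).eval (finGammaTwo L v γH)) w) = Valued.v ((toPlace v w (HeckeCharacter.uniformizer ↥(maximalRealSubfield L) v : v.adicCompletion ↥(maximalRealSubfield L))) ^ m) →
          toPlace v w (β : v.adicCompletion ↥(maximalRealSubfield L)) = -(((finCharpolyTwo L v γH).eval (finGammaTwo L v γH)) w * (finGammaTwo L v γH w ^ 2 + ((γH.1.val.val : Matrix (Fin 2) (Fin 2) (UnitaryGroup.LocalRing L v)).map (Pi.evalRingHom (fun w' : UnitaryGroup.PlacesOver L v => w'.1.adicCompletion L) w)).det)) / (2 * finGammaTwo L v γH w ^ 2 * ((γH.1.val.val : Matrix (Fin 2) (Fin 2) (UnitaryGroup.LocalRing L v)).map (Pi.evalRingHom (fun w' : UnitaryGroup.PlacesOver L v => w'.1.adicCompletion L) w)).det) →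
          ∀ (δp δm : ((UnitaryGroup.cmDatum L 3 (Matrix.of fun i j : Fin 3 => if i.val + j.val + 1 = 3 then (1 : L) else 0)).Local v)), IsLocalNormPair L (Matrix.of fun i j : Fin 3 => if i.val + j.val + 1 = 3 then (1 : L) else 0) v γH δp → finKappaAt L v (Matrix.of fun i j : Fin 3 => if i.val + j.val + 1 = 3 then (1 : L) else 0) γH δp = 1 → IsLocalNormPair L (Matrix.of fun i j : Fin 3 => if i.val + j.val + 1 = 3 then (1 : L) else 0) v γH δm → finKappaAt L v (Matrix.of fun i j : Fin 3 => if i.val + j.val + 1 = 3 then (1 : L) else 0) γH δm = -1 →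
          (((Fintype.card (Valued.ResidueField (w.1.adicCompletion L)) : ℕ) : ℂ) - 1) * ((Literature.NumberTheory.QuadraticForms.hilbertSymbol (v.adicCompletion ↥(maximalRealSubfield L)) (β : v.adicCompletion ↥(maximalRealSubfield L)) (algebraMap ↥(maximalRealSubfield L) _ ((cmQuadraticGenerator L : 𝓞 ↥(maximalRealSubfield L)) : ↥(maximalRealSubfield L))) : ℂ) * (((Nat.card (𝓞 ↥(maximalRealSubfield L) ⧸ v.asIdeal) : ℂ) ^ m))⁻¹ *
          ((({M : Submodule (Valued.integer (w.1.adicCompletion L)) (Fin 3 → (w.1.adicCompletion L)) | IsVertexLattice (galAdicCompletionMap (L := L) (IsCMField.complexConj L) hw) ϖ ((StdForm.antidiagonal 3).over (w.1.adicCompletion L)) 0 M ∧ mapGL ((localNonsplitEquiv (IsCMField.complexConj L) (Matrix.of fun i j : Fin 3 => if i.val + j.val + 1 = 3 then (1 : L) else 0) (IsCMField.complexConj_ne_one L) w hw δp : ↥(unitaryGroupOfForm (galAdicCompletionMap (L := L) (IsCMField.complexConj L) hw) (placeForm (Matrix.of fun i j : Fin 3 => if i.val + j.val + 1 = 3 then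 (1 : L) else 0) w.1))) : GL (Fin 3) (w.1.adicCompletion L)) M = M}.ncard : ℕ) : ℂ) - (({M : Submodule (Valued.integer (w.1.adicCompletion L)) (Fin 3 → (w.1.adicCompletion L)) | IsVertexLattice (galAdicCompletionMap (L := L) (IsCMField.complexConj L) hw) ϖ ((StdForm.antidiagonal 3).over (w.1.adicCompletion L)) 0 M ∧ mapGL ((localNonsplitEquiv (IsCMField.complexConj L) (Matrix.of fun i j : Fin 3 => if i.val + j.val + 1 = 3 then (1 : L) else 0) (IsCMField.complexConj_ne_one L) w hw δm : ↥(unitaryGroupOfForm (galAdicCompletionMap (L := L) (IsCMField.complexConj L) hw) (placeForm (Matrix.of fun i j : Fin 3 => if i.val + j.val + 1 = 3 then (1 : L) else 0) w.1))) : GL (Fin 3) (w.1.adicCompletion L)) M = M}.ncard : ℕ) : ℂ))) =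
          ((NV L v w hw γH : ℕ) : ℂ) - 2 - 2 * (((Fintype.card (Valued.ResidueField (w.1.adicCompletion L)) : ℕ) : ℂ) ^ (shiftR d tE) - 1)) :
    ∀ (L : Type) [Field L] [NumberField L] [IsCMField L]
    {v : HeightOneSpectrum (𝓞 ↥(maximalRealSubfield L))} (w : UnitaryGroup.PlacesOver L v)
    (hw : IsCMField.complexConj L • w.1 = w.1) (_he : v.asIdeal.ramificationIdx' w.1.asIdeal ≠ 1)
    (_h2 : ¬ IsUnit (2 : 𝒪[w.1.adicCompletion L]))
    (ϖ : (w.1.adicCompletion L)) (_hϖ : Valued.v ϖ = WithZero.exp (-1 : ℤ)) (d tE : ℕ) (_hD : IsRamifiedQuadraticDatum (galAdicCompletionMap (L := L) (IsCMField.complexConj L) hw) ϖ d tE)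
    [Fintype (Valued.ResidueField (w.1.adicCompletion L))],
    ∃ V ∈ 𝓝 (1 : ((UnitaryGroup.cmDatum L 2 (Matrix.of fun i j : Fin 2 => if i.val + j.val + 1 = 2 then (1 : L) else 0)).Local v × (UnitaryGroup.cmDatum L 1 (Matrix.of fun i j : Fin 1 => if i.val + j.val + 1 = 1 then (1 : L) else 0)).Local v)), ∀ γH ∈ V, IsLocalGRegular L v γH →
    ¬ (∃ x : (w.1.adicCompletion L), (((((γH).1.val : GL (Fin 2) (UnitaryGroup.LocalRing L v)).val.map (Pi.evalRingHom (fun w' : UnitaryGroup.PlacesOver L v => w'.1.adicCompletion L) w))).charpoly).IsRoot x) →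
    ∀ (m : ℕ) (β : (v.adicCompletion ↥(maximalRealSubfield L))ˣ), Valued.v (((finCharpolyTwo L v γH).eval (finGammaTwo L v γH)) w) = Valued.v ((toPlace v w (HeckeCharacter.uniformizer ↥(maximalRealSubfield L) v : v.adicCompletion ↥(maximalRealSubfield L))) ^ m) →
    toPlace v w (β : v.adicCompletion ↥(maximalRealSubfield L)) = -(((finCharpolyTwo L v γH).eval (finGammaTwo L v γH)) w * (finGammaTwo L v γH w ^ 2 + ((γH.1.val.val : Matrix (Fin 2) (Fin 2) (UnitaryGroup.LocalRing L v)).map (Pi.evalRingHom (fun w' : UnitaryGroup.PlacesOver L v => w'.1.adicCompletion L) w)).det)) / (2 * finGammaTwo L v γH w ^ 2 * ((γH.1.val.val : Matrix (Fin 2) (Fin 2) (UnitaryGroup.LocalRing L v)).map (Pi.evalRingHom (fun w' : UnitaryGroup.PlacesOver L v => w'.1.adicCompletion L) w)).det) →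
    ∀ (δp δm : ((UnitaryGroup.cmDatum L 3 (Matrix.of fun i j : Fin 3 => if i.val + j.val + 1 = 3 then (1 : L) else 0)).Local v)), IsLocalNormPair L (Matrix.of fun i j : Fin 3 => if i.val + j.val + 1 = 3 then (1 : L) else 0) v γH δp → finKappaAt L v (Matrix.of fun i j : Fin 3 => if i.val + j.val + 1 = 3 then (1 : L) else 0) γH δp = 1 → IsLocalNormPair L (Matrix.of fun i j : Fin 3 => if i.val + j.val + 1 = 3 then (1 : L) else 0) v γH δm → finKappaAt L v (Matrix.of fun i j : Fin 3 => if i.val + j.val + 1 = 3 then (1 : L) else 0) γH δm = -1 →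
    (Literature.NumberTheory.QuadraticForms.hilbertSymbol (v.adicCompletion ↥(maximalRealSubfield L)) (β : v.adicCompletion ↥(maximalRealSubfield L)) (algebraMap ↥(maximalRealSubfield L) _ ((cmQuadraticGenerator L : 𝓞 ↥(maximalRealSubfield L)) : ↥(maximalRealSubfield L))) : ℂ) * (((Nat.card (𝓞 ↥(maximalRealSubfield L) ⧸ v.asIdeal) : ℂ) ^ m))⁻¹ *
    ((({M : Submodule (Valued.integer (w.1.adicCompletion L)) (Fin 3 → (w.1.adicCompletion L)) | IsVertexLattice (galAdicCompletionMap (L := L) (IsCMField.complexConj L) hw) ϖ ((StdForm.antidiagonal 3).over (w.1.adicCompletion L)) 0 M ∧ mapGL ((localNonsplitEquiv (IsCMField.complexConj L) (Matrix.of fun i j : Fin 3 => if i.val + j.val + 1 = 3 then (1 : L) else 0) (IsCMField.complexConj_ne_one L) w hw δp : ↥(unitaryGroupOfForm (galAdicCompletionMap (L := L) (IsCMField.complexConj L) hw) (placeForm (Matrix.of fun i j : Fin 3 => if i.val + j.val + 1 = 3 then (1 : L) else 0) w.1))) : GL (Fin 3) (w.1.adicCompletion L)) M = M}.ncard : ℕ)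 : ℂ) - (({M : Submodule (Valued.integer (w.1.adicCompletion L)) (Fin 3 → (w.1.adicCompletion L)) | IsVertexLattice (galAdicCompletionMap (L := L) (IsCMField.complexConj L) hw) ϖ ((StdForm.antidiagonal 3).over (w.1.adicCompletion L)) 0 M ∧ mapGL ((localNonsplitEquiv (IsCMField.complexConj L) (Matrix.of fun i j : Fin 3 => if i.val + j.val + 1 = 3 then (1 : L) else 0) (IsCMField.complexConj_ne_one L) w hw δm : ↥(unitaryGroupOfForm (galAdicCompletionMap (L := L) (IsCMField.complexConj L) hw) (placeForm (Matrix.of fun i j : Fin 3 => if i.val + j.val + 1 = 3 then (1 : L) else 0) w.1))) : GL (Fin 3) (w.1.adicCompletion L)) M = M}.ncard : ℕ) : ℂ)) =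
    ((Nat.card (MulAction.fixedBy (((UnitaryGroup.cmDatum L 2 (Matrix.of fun i j : Fin 2 => if i.val + j.val + 1 = 2 then (1 : L) else 0)).Local v) ⧸ cmLocalIntegralLevel L 2 (Matrix.of fun i j : Fin 2 => if i.val + j.val + 1 = 2 then (1 : L) else 0) v) γH.1) : ℂ) + ((d % 2 : ℕ) : ℂ)) - 2 * (((Fintype.card (Valued.ResidueField (w.1.adicCompletion L)) : ℕ) : ℂ) ^ (shiftR d tE) - 1) / (((Fintype.card (Valued.ResidueField (w.1.adicCompletion L)) : ℕ) : ℂ) - 1) := by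
  intro L _ _ _ v w hw he h2 ϖ hϖ d tE hD _
  obtain ⟨VH, hVH, hH'⟩ := hH L w hw he h2 ϖ hϖ d tE hD
  obtain ⟨VG, hVG, hG'⟩ := hG L w hw he h2 ϖ hϖ d tE hD
  refine ⟨VH ∩ VG, Filter.inter_mem hVH hVG, fun γH hγ hreg hirr m β hmt hβ δp δm hp hκp hm hκm => ?_⟩
  have eH := hH' γH hγ.1 hreg hirr
  have eG := hG' γH hγ.2 hreg hirr m β hmt hβ δp δm hp hκp hm hκm
  have hq : ((Fintype.card (Valued.ResidueField (w.1.adicCompletion L)) : ℕ) : ℂ) - 1 ≠ 0 := by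
    have h1 : 1 < Fintype.card (Valued.ResidueField (w.1.adicCompletion L)) := Fintype.one_lt_card
    rw [sub_ne_zero]
    exact_mod_cast h1.ne'
  generalize ((Fintype.card (Valued.ResidueField (w.1.adicCompletion L)) : ℕ) : ℂ) = Q at eH eG hq ⊢
  generalize ((NV L v w hw γH : ℕ) : ℂ) = N at eH eG
  have hFD : ((Nat.card (MulAction.fixedBy (((UnitaryGroup.cmDatum L 2 (Matrix.of fun i j : Fin 2 => if i.val + j.val + 1 = 2 then (1 : L) else 0)).Local v) ⧸ cmLocalIntegralLevel L 2 (Matrix.of fun i j : Fin 2 => if i.val + j.val + 1 = 2 then (1 : L) else 0) v) γH.1) : ℂ) + ((d % 2 : ℕ) : ℂ)) = (N - 2) / (Q - 1) := by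
    rw [eq_div_iff hq]
    linear_combination eH
  rw [hFD, div_sub_div_same, eq_div_iff hq]
  linear_combination eG

end Summit.HodgeConjecture.HodgeConjecture.Cruxes.H413.F0P3cDyRamFixedPointCensusTypeTwoSides

end
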